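import Mathlib
import Summits.ABC.ABC.Theses.TwistAmplification

/-!
# Sketch — crux-ideate stmt-ABC-1976 (SomeWindowSaving), ideator 1, round 1

First lemmas of the two idea cards (statements only; they must elaborate, not be proved):

* `hyperbolic-level-descent`  → `darmonPart`, `DarmonSliceBound`   (the ONE card filed)
* withdrawn second card `mordell-family-averaging` → `MordellIntegralPointsOnAverage`,
  `DiscriminantCountAlmostLinear`, `TinyDiscriminantSlice`: kept only as CALIBRATION — the
  discriminant count is Fouvry–Nair–Tenenbaum 1992 Thm 1 at K = 1 (S₀(D;1) ≪ D^{1+o(1)}), so the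
  tiny-discriminant slice is free and the lever adds nothing (NOTES `## Barrier notes` (c)).
plus the calibration `WeakHallSomeExponent` (crux ⟹ weak Hall; NOTES `## Barrier notes` (a)).
-/

namespace Summit.ABC.ABC.Cruxes.SomeWindowSaving.Sketch

open Summit.ABC.ABC.Theses.TwistAmplification

/-- The window predicate of the crux, factored out: reduced minimal integral model, elliptic,
`c₄ c₆ ≠ 0`, conductor `≤ X`, generalized Szpiro size `N^κ ≤ M⁺ ≤ N^σ`. -/
def InWindow (κ σ X : ℝ) (W₀ : WeierstrassCurve ℤ) : Prop :=
  (W₀.baseChange ℚ).IsElliptic ∧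
  (∀ v : IsDedekindDomain.HeightOneSpectrum ℤ, (W₀.baseChange ℚ).IsMinimalAt v) ∧
  (W₀.a₁ = 0 ∨ W₀.a₁ = 1) ∧ (W₀.a₃ = 0 ∨ W₀.a₃ = 1) ∧ (W₀.a₂ = -1 ∨ W₀.a₂ = 0 ∨ W₀.a₂ = 1) ∧
  W₀.c₄ ≠ 0 ∧ W₀.c₆ ≠ 0 ∧
  (((W₀.baseChange ℚ).conductorNorm ℤ : ℕ) : ℝ) ≤ X ∧
  (((W₀.baseChange ℚ).conductorNorm ℤ : ℕ) : ℝ) ^ κ ≤ ((max |W₀.Δ| (|W₀.c₄| ^ 3) : ℤ) : ℝ) ∧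
  ((max |W₀.Δ| (|W₀.c₄| ^ 3) : ℤ) : ℝ) ≤ (((W₀.baseChange ℚ).conductorNorm ℤ : ℕ) : ℝ) ^ σ

/-- Sanity: the crux is the window count with `∃ κ σ δ C`. -/
example : SomeWindowSaving ↔
    ∃ κ σ δ C : ℝ, 3 < κ ∧ κ < σ ∧ δ < (σ - κ) / (2 * σ - 6) ∧ ∀ X : ℝ, 1 ≤ X →
      (Set.ncard {W₀ : WeierstrassCurve ℤ | InWindow κ σ X W₀} : ℝ) ≤ C * X ^ δ :=
  Iff.rfl

/-- The `ℓ`-DARMON PART of a model: the product of the primes `p ∥ N` (multiplicative reduction)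
whose discriminant exponent is divisible by `ℓ` — exactly the primes at which `E[ℓ]` is unramified
(Tate curve), i.e. the primes Ribet's theorem removes from the level. -/
noncomputable def darmonPart (ℓ : ℕ) (W₀ : WeierstrassCurve ℤ) : ℕ :=
  (((W₀.baseChange ℚ).conductorNorm ℤ).primeFactors.filter
      (fun p => ¬ p ^ 2 ∣ (W₀.baseChange ℚ).conductorNorm ℤ ∧ ℓ ∣ W₀.Δ.natAbs.factorization p)).prod id

/-- FIRST LEMMA of card `hyperbolic-level-descent` (Darmon-slice bound, ℓ = 11): inside the
window, the curves whose 11-Darmon part carries a share `≥ ϑ` of the conductor, for SOME `ϑ < 1`,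
are `≪ X^δ` for some `δ < 1/2` (expected: any `ϑ > 3/4 + σ/660`, `δ = 2(1−ϑ) + σ/330 + ε`, see
`DarmonSliceBoundExplicit`; the height-distortion constant of the twists `X_ρ̄(11)` is the caveat). Inputs: Ribet level-lowering + `dim S₂(Γ₀(m)) ≪ m`
(number of residual representations `≪ M²`, `M = N / darmonPart`), moduli interpretation of
`X_ρ̄^±(11)` (genus 26), Heath-Brown's uniform `B^{2/d+ε}` for points on curves. -/
def DarmonSliceBound : Prop :=
  ∀ σ : ℝ, 6 < σ → ∃ ϑ δ C : ℝ, ϑ < 1 ∧ δ < 1 / 2 ∧ ∀ X : ℝ, 1 ≤ X →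
    (Set.ncard {W₀ : WeierstrassCurve ℤ | InWindow 3 σ X W₀ ∧
        (((W₀.baseChange ℚ).conductorNorm ℤ : ℕ) : ℝ) ^ ϑ ≤ (darmonPart 11 W₀ : ℝ)} : ℝ)
      ≤ C * X ^ δ

/-- Explicit form expected from the proof sketch (Heath-Brown fibre count, height distortion absorbed
in `ε`): share `ϑ` of the conductor in the 11-Darmon part gives exponent `2(1−ϑ) + σ/330 + ε`,
below `1/2` as soon as `ϑ > 3/4 + σ/660`. -/
def DarmonSliceBoundExplicit : Prop :=
  ∀ σ ϑ ε : ℝ, 6 < σ → 3 / 4 < ϑ → ϑ < 1 → 0 < ε → ∃ C : ℝ, ∀ X : ℝ, 1 ≤ X →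
    (Set.ncard {W₀ : WeierstrassCurve ℤ | InWindow 3 σ X W₀ ∧
        (((W₀.baseChange ℚ).conductorNorm ℤ : ℕ) : ℝ) ^ ϑ ≤ (darmonPart 11 W₀ : ℝ)} : ℝ)
      ≤ C * X ^ (2 * (1 - ϑ) + σ / 330 + ε)

/-- FIRST LEMMA of card `mordell-family-averaging`: the integral points on the Mordell curves
`y² = x³ + k`, `0 < |k| ≤ K`, number `≪ K^{1+ε}` in total (Helfgott–Venkatesh Thm 3.8 at `t = 0`:
`≪ |k|^ε e^{(β(0)+ε) r}`, `e^{β(0)} = 1.3207…`; Bhargava–Elkies–Shnidman: the average sizes of the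
3-isogeny Selmer groups of `y² = x³ + k` are bounded; Hölder with `2 log₃ 1.3207 = 0.507 < 1`). -/
def MordellIntegralPointsOnAverage : Prop :=
  ∀ ε : ℝ, 0 < ε → ∃ C : ℝ, ∀ K : ℕ, 1 ≤ K →
    (Set.ncard {t : ℤ × ℤ × ℤ | t.2.2 ≠ 0 ∧ |t.2.2| ≤ (K : ℤ) ∧ t.2.1 ^ 2 = t.1 ^ 3 + t.2.2} : ℝ)
      ≤ C * (K : ℝ) ^ (1 + ε)

/-- Consequence: elliptic curves over ℚ counted by MINIMAL DISCRIMINANT are `≪ K^{1+ε}`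
(`(c₄, c₆)` of a minimal model is an integral point on `y² = x³ − 1728 Δ`). -/
def DiscriminantCountAlmostLinear : Prop :=
  ∀ ε : ℝ, 0 < ε → ∃ C : ℝ, ∀ K : ℝ, 1 ≤ K →
    (Set.ncard {W₀ : WeierstrassCurve ℤ | (W₀.baseChange ℚ).IsElliptic ∧
        (∀ v : IsDedekindDomain.HeightOneSpectrum ℤ, (W₀.baseChange ℚ).IsMinimalAt v) ∧
        (W₀.a₁ = 0 ∨ W₀.a₁ = 1) ∧ (W₀.a₃ = 0 ∨ W₀.a₃ = 1) ∧ (W₀.a₂ = -1 ∨ W₀.a₂ = 0 ∨ W₀.a₂ = 1) ∧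
        (|W₀.Δ| : ℝ) ≤ K} : ℝ) ≤ C * K ^ (1 + ε)

/-- The tiny-discriminant slice of the window (`|Δ| ≤ X^{1/2−η}`) has a power saving below `1/2`. -/
def TinyDiscriminantSlice : Prop :=
  ∀ κ σ η ε : ℝ, 3 < κ → κ < σ → 0 < η → η < 1 / 2 → 0 < ε → ∃ C : ℝ, ∀ X : ℝ, 1 ≤ X →
    (Set.ncard {W₀ : WeierstrassCurve ℤ | InWindow κ σ X W₀ ∧ (|W₀.Δ| : ℝ) ≤ X ^ (1 / 2 - η)} : ℝ)
      ≤ C * X ^ (1 / 2 - η + ε)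

/-- The slice bound is literally a corollary of the discriminant count (drop the window). -/
theorem tinyDiscriminantSlice_of_discriminantCount (h : DiscriminantCountAlmostLinear) :
    TinyDiscriminantSlice := by
  intro κ σ η ε hκ hκσ hη hη2 hε
  obtain ⟨C, hC⟩ := h (ε / (1 / 2 - η)) (by positivity)
  sorry

/-- Calibration recorded in NOTES (`## Barrier notes`): the crux implies WEAK HALL with some
exponent — `|x³ − y²| ≥ c |x|^θ`, `θ > 0` — of which no instance is known (Elkies 2000;
`Literature.Barriers.ABC.HallExponentSharp`). Shape of the target statement: -/
def WeakHallSomeExponent : Prop :=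
  ∃ θ c : ℝ, 0 < θ ∧ 0 < c ∧ ∀ x y : ℤ, x ^ 3 ≠ y ^ 2 → c * (|x| : ℝ) ^ θ ≤ (|x ^ 3 - y ^ 2| : ℝ)

end Summit.ABC.ABC.Cruxes.SomeWindowSaving.Sketch

/-! ## Second card `smooth-cofactor-mordell-averaging` (first lemmas) -/

namespace Summit.ABC.ABC.Cruxes.SomeWindowSaving.Sketch

/-- The `P`-ROUGH PART of a natural number: the product of its prime-power factors at primes `> P`
(so `n = (P-smooth part) · roughPart P n`). -/
def roughPart (P n : ℕ) : ℕ :=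
  ∏ p ∈ n.primeFactors.filter (fun p => P < p), p ^ n.factorization p

/-- FIRST LEMMA of card `smooth-cofactor-mordell-averaging` (twisted Mordell equations on average):
for a fixed finite set of primes `S = {p ≤ P}`, the `S`-integral points `(a/u², b/u³)` on the Mordell
curves `y² = x³ + k`, `0 < |k| ≤ K` — i.e. the solutions of `b² = a³ + k·u⁶` with `u` an `S`-unit
coprime to `a` — number `≪_{P,ε} K^{1+ε}`, uniformly in `u` (Helfgott–Venkatesh Thm 3.8 for
`S`-integral points at `t = 0` + Bhargava–Elkies–Shnidman's bounded average 3-isogeny Selmer over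
all `k` + Hölder). -/
def TwistedMordellOnAverage : Prop :=
  ∀ (P : ℕ) (ε : ℝ), 0 < ε → ∃ C : ℝ, ∀ K : ℕ, 1 ≤ K →
    (Set.ncard {t : ℤ × ℤ × ℕ × ℤ | t.2.2.2 ≠ 0 ∧ |t.2.2.2| ≤ (K : ℤ) ∧ 0 < t.2.2.1 ∧
        (∀ p : ℕ, p.Prime → p ∣ t.2.2.1 → p ≤ P) ∧ Int.gcd t.1 t.2.2.1 = 1 ∧
        t.2.1 ^ 2 = t.1 ^ 3 + t.2.2.2 * (t.2.2.1 : ℤ) ^ 6} : ℝ) ≤ C * (K : ℝ) ^ (1 + ε)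

/-- Consequence (index by the `S`-rough part of the discriminant): elliptic curves over ℚ whose
minimal discriminant has `P`-rough part `≤ Y` are `≪_{P,ε} Y^{1+ε}` — with NO bound on the
`P`-smooth part `∏_{p ≤ P} p^{v_p(Δ)}` (arbitrarily fat exponents at the small primes). -/
def SmoothCofactorCount : Prop :=
  ∀ (P : ℕ) (ε : ℝ), 0 < ε → ∃ C : ℝ, ∀ Y : ℝ, 1 ≤ Y →
    (Set.ncard {W₀ : WeierstrassCurve ℤ | (W₀.baseChange ℚ).IsElliptic ∧
        (∀ v : IsDedekindDomain.HeightOneSpectrum ℤ, (W₀.baseChange ℚ).IsMinimalAt v) ∧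
        (W₀.a₁ = 0 ∨ W₀.a₁ = 1) ∧ (W₀.a₃ = 0 ∨ W₀.a₃ = 1) ∧ (W₀.a₂ = -1 ∨ W₀.a₂ = 0 ∨ W₀.a₂ = 1) ∧
        (roughPart P W₀.Δ.natAbs : ℝ) ≤ Y} : ℝ) ≤ C * Y ^ (1 + ε)

/-- The smooth-cofactor slice of the window (`P`-rough part of `Δ` below `X^{1/2−η}`) has a power
saving below `1/2`; it is literally `SmoothCofactorCount` with `Y = X^{1/2−η}` (window unused). -/
def SmoothCofactorSlice : Prop :=
  ∀ (P : ℕ) (κ σ η ε : ℝ), 3 < κ → κ < σ → 0 < η → η < 1 / 2 → 0 < ε → ∃ C : ℝ, ∀ X : ℝ, 1 ≤ X →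
    (Set.ncard {W₀ : WeierstrassCurve ℤ | InWindow κ σ X W₀ ∧
        (roughPart P W₀.Δ.natAbs : ℝ) ≤ X ^ (1 / 2 - η)} : ℝ) ≤ C * X ^ ((1 / 2 - η) * (1 + ε))

end Summit.ABC.ABC.Cruxes.SomeWindowSaving.Sketch
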